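import Summits.CriticalPhenomena.PercolationContinuityZ3.Theorems.PercNearOneGluingNoHeavyLowerTailSunflowerMultiPetalKempeConnected
import Summits.CriticalPhenomena.PercolationContinuityZ3.Theorems.PercNearOneGluingNoHeavyLowerTailSunflowerMultiPetalTypeUnion
import HarnessLib
import HarnessLib.Audit

/-!
# `NoHeavyLowerTail` (crux stmt-CriticalPhenomena-4575), Lemma B for graph clutters: THEOREM A IN COLOURING LANGUAGE (Lemma B is closed under
# splitting a graph along an empty cut) and LEMMA B FOR ALL GRAPHS FROM THE CONNECTED ONE-POINT OBLIGATION `MZQConnected`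

Support file (seat `prim-l12-p2` gen 40; `--supports stmt-CriticalPhenomena-4575`; companion of `…SunflowerMultiPetalTypeUnion` (p385801: `CType`,
`ctAdd`, `lbW`, THEOREM A `lemmaB_pair_nonneg`), `…SunflowerMultiPetalKempeNormalForm` (p408427: `Qcol`, `cnt`) and `…SunflowerMultiPetalKempeConnected`
(p409076: `MZQConnected`, `Qcol_nonneg_of_connected'`)).  No `sorry`; nothing is asserted about the crux.
Memo: run/shared/lean/prim/prim-l12/prim-l12-p2/FINDING-g40-KEMPE-IDENTITY-LEAN-AND-CONNECTED-SLACK.md §2.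

* `ctype`, `tv` : the capped type `(X_c ∧ 2)_c` of a colouring and the TYPE VECTOR `tv G t = #{σ : ctype σ = t}`; `Qcol_eq_sum_tv : Qcol G = Σ_t lbW t · tv G t`
  (`lbW_caps`, a finite check), `tv_swap12 / tv_swap23` (colour symmetry).
* `cnt_split` : along an EMPTY CUT `(S, Sᶜ)` the colour counts add, so `tv G = tv G[S] ⊛ tv G[Sᶜ]` (`Qcol_eq_sum_pair`), and THEOREM A gives
  `Qcol_nonneg_of_emptyCut : 0 ≤ Qcol G[S] → 0 ≤ Qcol G[Sᶜ] → 0 ≤ Qcol G`.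
* `Qcol_nonneg_of_MZQConnected : MZQConnected → ∀ G, 0 ≤ Qcol G` — a disconnected graph splits along a connected component, a connected one peels
  a non-cut vertex (p409076): Lemma B for EVERY finite graph follows from the connected one-point obligation alone.
-/

namespace Summit.CriticalPhenomena.PercolationContinuityZ3.Theorems.SunflowerPartition.Kempe

open Finset
open scoped Classical

variable {V : Type*} [Fintype V] (G : SimpleGraph V)

/-! ## Capped types and the type vector -/

/-- A natural number capped at `2`, as an element of `Fin 3`. [this work] -/
def cap3 (n : ℕ) : Fin 3 := ⟨min n 2, by omega⟩

/-- `2 ≤ n ↔ cap3 n = 2`. [this work] -/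
theorem two_le_iff_cap3 (n : ℕ) : 2 ≤ n ↔ cap3 n = 2 := by
  unfold cap3; rw [Fin.ext_iff]; simp only [Fin.val_two]; omega

/-- `n = 0 ↔ cap3 n = 0`. [this work] -/
theorem eq_zero_iff_cap3 (n : ℕ) : n = 0 ↔ cap3 n = 0 := by
  unfold cap3; rw [Fin.ext_iff]; simp only [Fin.val_zero]; omega

/-- `n = 1 ↔ cap3 n = 1`. [this work] -/
theorem eq_one_iff_cap3 (n : ℕ) : n = 1 ↔ cap3 n = 1 := by
  unfold cap3; rw [Fin.ext_iff]; simp only [Fin.val_one]; omega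

/-- Capped addition: `cap3 (a + b) = capAdd (cap3 a) (cap3 b)`. [this work] -/
theorem cap3_add (a b : ℕ) : cap3 (a + b) = capAdd (cap3 a) (cap3 b) := by
  unfold cap3 capAdd; apply Fin.ext; simp only; omega

/-- The weight table `lbW` on capped types is `2·[002] − [011] − [111]` (finite check). [this work] -/
theorem lbW_caps : ∀ g : Fin 3 → Fin 3, lbW (g 0, g 1, g 2) =
    (if ∃ c, g c = 2 ∧ ∀ c', c' ≠ c → g c' = 0 then (2 : ℤ) else 0)
      - (if (∃ c, g c = 0 ∧ ∀ c', c' ≠ c → g c' = 1) ∨ ∀ c, g c = 1 then 1 else 0) := by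
  decide

/-- The capped type of a colouring. [this work] -/
noncomputable def ctype (σ : V → Fin 3) : CType := (cap3 (cnt G σ 0), cap3 (cnt G σ 1), cap3 (cnt G σ 2))

/-- `lbW` of the capped type is the Lemma-B weight `qcol`. [this work] -/
theorem lbW_ctype (σ : V → Fin 3) : lbW (ctype G σ) = qcol G σ := by
  unfold ctype
  rw [lbW_caps (fun c => cap3 (cnt G σ c))]
  unfold qcol IsPos IsNeg
  simp only [two_le_iff_cap3, eq_zero_iff_cap3, eq_one_iff_cap3]

/-- The TYPE VECTOR of `G`: the number of colourings of each capped type. [this work] -/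
noncomputable def tv (t : CType) : ℤ := ((univ : Finset (V → Fin 3)).filter fun σ => ctype G σ = t).card

/-- `tv ≥ 0`. [this work] -/
theorem tv_nonneg (t : CType) : 0 ≤ tv G t := by unfold tv; positivity

/-- **`Q(G) = Σ_t lbW t · tv t`.** [this work] -/
theorem Qcol_eq_sum_tv : Qcol G = ∑ t : CType, lbW t * tv G t := by
  unfold Qcol tv
  rw [← sum_fiberwise_of_maps_to (s := (univ : Finset (V → Fin 3))) (t := (univ : Finset CType)) (g := ctype G) (fun _ _ => mem_univ _)]
  refine sum_congr rfl fun t _ => ?_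
  rw [sum_congr rfl fun σ hσ => by rw [← lbW_ctype, (mem_filter.1 hσ).2], sum_const, nsmul_eq_mul, mul_comm]

/-! ## Colour symmetry of the type vector -/

/-- Relabelling the colours by an injection relabels the colour counts. [this work] -/
theorem cnt_comp (σ : V → Fin 3) (π : Fin 3 → Fin 3) (hπ : Function.Injective π) (c : Fin 3) :
    cnt G (π ∘ σ) (π c) = cnt G σ c := by
  unfold cnt monoCol
  congr 1
  ext e
  simp only [mem_filter, and_congr_right_iff]
  intro _
  rw [← Sym2.map_map]
  constructor
  · intro h
    exact Sym2.map.injective hπ (by rw [h, Sym2.map_mk])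
  · intro h
    rw [h, Sym2.map_mk]

/-- The transposition `0 ↔ 1` of the colours. [this work] -/
def sw01 (c : Fin 3) : Fin 3 := if c = 0 then 1 else if c = 1 then 0 else c

/-- The transposition `1 ↔ 2` of the colours. [this work] -/
def sw12 (c : Fin 3) : Fin 3 := if c = 1 then 2 else if c = 2 then 1 else c

/-- `sw01` is an involution. [this work] -/
theorem sw01_sw01 : ∀ c, sw01 (sw01 c) = c := by decide
/-- `sw12` is an involution. [this work] -/
theorem sw12_sw12 : ∀ c, sw12 (sw12 c) = c := by decide
/-- `sw01` is injective. [this work] -/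
theorem sw01_injective : Function.Injective sw01 := fun a b h => by rw [← sw01_sw01 a, h, sw01_sw01]
/-- `sw12` is injective. [this work] -/
theorem sw12_injective : Function.Injective sw12 := fun a b h => by rw [← sw12_sw12 a, h, sw12_sw12]

/-- Type of a `0 ↔ 1`-relabelled colouring. [this work] -/
theorem ctype_sw01 (σ : V → Fin 3) : ctype G (sw01 ∘ σ) = ctSwap12 (ctype G σ) := by
  unfold ctype ctSwap12
  have h0 := cnt_comp G σ sw01 sw01_injective 0
  have h1 := cnt_comp G σ sw01 sw01_injective 1
  have h2 := cnt_comp G σ sw01 sw01_injective 2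
  simp only [sw01, show (0 : Fin 3) ≠ 1 by decide, show (1 : Fin 3) ≠ 0 by decide, show (2 : Fin 3) ≠ 0 by decide,
    show (2 : Fin 3) ≠ 1 by decide, if_true, if_false] at h0 h1 h2
  rw [h0, h1, h2]

/-- Type of a `1 ↔ 2`-relabelled colouring. [this work] -/
theorem ctype_sw12 (σ : V → Fin 3) : ctype G (sw12 ∘ σ) = ctSwap23 (ctype G σ) := by
  unfold ctype ctSwap23
  have h0 := cnt_comp G σ sw12 sw12_injective 0
  have h1 := cnt_comp G σ sw12 sw12_injective 1
  have h2 := cnt_comp G σ sw12 sw12_injective 2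
  simp only [sw12, show (0 : Fin 3) ≠ 1 by decide, show (0 : Fin 3) ≠ 2 by decide, show (1 : Fin 3) ≠ 2 by decide,
    show (2 : Fin 3) ≠ 1 by decide, if_true, if_false] at h0 h1 h2
  rw [h0, h1, h2]

/-- `ctSwap12` is an involution. [this work] -/
theorem ctSwap12_ctSwap12 (t : CType) : ctSwap12 (ctSwap12 t) = t := rfl
/-- `ctSwap23` is an involution. [this work] -/
theorem ctSwap23_ctSwap23 (t : CType) : ctSwap23 (ctSwap23 t) = t := rfl

/-- Colour symmetry `0 ↔ 1` of the type vector. [this work] -/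
theorem tv_swap12 (t : CType) : tv G (ctSwap12 t) = tv G t := by
  unfold tv
  congr 1
  refine card_nbij' (fun σ : V → Fin 3 => sw01 ∘ σ) (fun σ : V → Fin 3 => sw01 ∘ σ) (fun σ hσ => ?_) (fun σ hσ => ?_) (fun σ _ => ?_) (fun σ _ => ?_)
  · rw [mem_coe, mem_filter] at hσ ⊢
    exact ⟨mem_univ _, by rw [ctype_sw01, hσ.2, ctSwap12_ctSwap12]⟩
  · rw [mem_coe, mem_filter] at hσ ⊢
    exact ⟨mem_univ _, by rw [ctype_sw01, hσ.2]⟩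
  · funext v; exact sw01_sw01 _
  · funext v; exact sw01_sw01 _

/-- Colour symmetry `1 ↔ 2` of the type vector. [this work] -/
theorem tv_swap23 (t : CType) : tv G (ctSwap23 t) = tv G t := by
  unfold tv
  congr 1
  refine card_nbij' (fun σ : V → Fin 3 => sw12 ∘ σ) (fun σ : V → Fin 3 => sw12 ∘ σ) (fun σ hσ => ?_) (fun σ hσ => ?_) (fun σ _ => ?_) (fun σ _ => ?_)
  · rw [mem_coe, mem_filter] at hσ ⊢
    exact ⟨mem_univ _, by rw [ctype_sw12, hσ.2, ctSwap23_ctSwap23]⟩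
  · rw [mem_coe, mem_filter] at hσ ⊢
    exact ⟨mem_univ _, by rw [ctype_sw12, hσ.2]⟩
  · funext v; exact sw12_sw12 _
  · funext v; exact sw12_sw12 _

/-! ## Splitting along an empty cut -/

section Split

variable (S : Set V)

omit [Fintype V] in
/-- Adjacency in an induced subgraph is adjacency of the underlying vertices. [this work] -/
theorem induce_adj_iff (a b : S) : (G.induce S).Adj a b ↔ G.Adj a.1 b.1 := Iff.rfl

/-- An edge of `G` lies INSIDE `S`. [this work] -/
def Inside (e : Sym2 V) : Prop := ∀ v ∈ e, v ∈ S

/-- The colour count of the induced subgraph on `S` counts the monochromatic edges of `G` inside `S`. [this work] -/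
theorem cnt_induce [Fintype ↥S] (σ : V → Fin 3) (c : Fin 3) :
    cnt (G.induce S) (σ ∘ Subtype.val) c = ((monoCol G σ c).filter fun e => Inside S e).card := by
  unfold cnt
  refine card_bij (fun e' _ => Sym2.map Subtype.val e') (fun e' he' => ?_)
    (fun e₁ _ e₂ _ h => Sym2.map.injective Subtype.val_injective h) (fun e he => ?_)
  · induction e' using Sym2.ind with
    | _ a b =>
      rw [mk_mem_monoCol_iff] at he'
      obtain ⟨hab, ha, hb⟩ := he'
      rw [Sym2.map_mk, mem_filter, mk_mem_monoCol_iff]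
      refine ⟨⟨(induce_adj_iff G S a b).1 hab, ha, hb⟩, fun v hv => ?_⟩
      rcases Sym2.mem_iff.1 hv with rfl | rfl
      · exact a.2
      · exact b.2
  · induction e using Sym2.ind with
    | _ u w =>
      rw [mem_filter, mk_mem_monoCol_iff] at he
      obtain ⟨⟨huw, hu, hw⟩, hin⟩ := he
      have huS : u ∈ S := hin u (Sym2.mem_mk_left _ _)
      have hwS : w ∈ S := hin w (Sym2.mem_mk_right _ _)
      refine ⟨s(⟨u, huS⟩, ⟨w, hwS⟩), ?_, by rw [Sym2.map_mk]⟩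
      rw [mk_mem_monoCol_iff]
      exact ⟨(induce_adj_iff G S _ _).2 huw, hu, hw⟩

/-- EMPTY CUT: no edge of `G` joins `S` to its complement. [this work] -/
def EmptyCut : Prop := ∀ u v, G.Adj u v → (u ∈ S ↔ v ∈ S)

variable {S}

omit [Fintype V] in
/-- Along an empty cut an edge inside `Sᶜ` is an edge not inside `S`. [this work] -/
theorem inside_compl_iff (hS : EmptyCut G S) {e : Sym2 V} (he : e ∈ G.edgeSet) : Inside Sᶜ e ↔ ¬Inside S e := by
  induction e using Sym2.ind with
  | _ u w =>
    have h := hS u w ((mk_mem_edgeSet_iff G u w).1 he)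
    unfold Inside
    simp only [Sym2.mem_iff, forall_eq_or_imp, forall_eq, Set.mem_compl_iff]
    tauto

/-- Along an empty cut the colour counts split: `X_c(σ) = X_c(σ|S) + X_c(σ|Sᶜ)`. [this work] -/
theorem cnt_split (hS : EmptyCut G S) (σ : V → Fin 3) (c : Fin 3) :
    cnt G σ c = cnt (G.induce S) (σ ∘ Subtype.val) c + cnt (G.induce Sᶜ) (σ ∘ Subtype.val) c := by
  have hA := cnt_induce G S σ c
  have hB := cnt_induce G Sᶜ σ c
  rw [hA, hB]
  have h2 : ((monoCol G σ c).filter fun e => Inside Sᶜ e) = (monoCol G σ c).filter fun e => ¬Inside S e := by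
    refine filter_congr fun e he => ?_
    exact inside_compl_iff G hS ((mem_monoCol G σ c e).1 he).1
  rw [h2, card_filter_add_card_filter_not]; rfl

/-- Along an empty cut the capped type is the capped sum of the types of the two sides. [this work] -/
theorem ctype_split (hS : EmptyCut G S) (σ : V → Fin 3) :
    ctype G σ = ctAdd (ctype (G.induce S) (σ ∘ Subtype.val)) (ctype (G.induce Sᶜ) (σ ∘ Subtype.val)) := by
  unfold ctype ctAdd
  rw [cnt_split G hS σ 0, cnt_split G hS σ 1, cnt_split G hS σ 2, cap3_add, cap3_add, cap3_add]

/-- Glue two colourings of the sides into a colouring of `V`. [this work] -/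
noncomputable def glue (p : (S → Fin 3) × (↥Sᶜ → Fin 3)) : V → Fin 3 :=
  fun v => if h : v ∈ S then p.1 ⟨v, h⟩ else p.2 ⟨v, h⟩

/-- The colourings of `V` with prescribed side types are in bijection with pairs of side colourings. [this work] -/
theorem card_pair_types (r u : CType) :
    (((univ : Finset (V → Fin 3)).filter fun σ =>
        ctype (G.induce S) (σ ∘ Subtype.val) = r ∧ ctype (G.induce Sᶜ) (σ ∘ Subtype.val) = u).card : ℤ)
      = tv (G.induce S) r * tv (G.induce Sᶜ) u := by
  unfold tv
  rw [← Nat.cast_mul, ← card_product]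
  congr 1
  refine card_nbij' (fun σ : V → Fin 3 => (σ ∘ Subtype.val, σ ∘ Subtype.val)) (fun p => glue p)
    (fun σ hσ => ?_) (fun p hp => ?_) (fun σ _ => ?_) (fun p _ => ?_)
  · rw [mem_coe, mem_filter] at hσ
    rw [mem_coe, mem_product, mem_filter, mem_filter]
    simp only [mem_univ, true_and]
    exact ⟨hσ.2.1, hσ.2.2⟩
  · rw [mem_coe, mem_product, mem_filter, mem_filter] at hp
    rw [mem_coe, mem_filter]
    have e1 : (glue p) ∘ (Subtype.val : S → V) = p.1 := by
      funext a; simp only [Function.comp, glue, dif_pos a.2]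
    have e2 : (glue p) ∘ (Subtype.val : ↥Sᶜ → V) = p.2 := by
      funext b; have hb : (b : V) ∉ S := b.2; simp only [Function.comp, glue, dif_neg hb]
    simp only [mem_univ, true_and]
    exact ⟨by rw [e1]; exact hp.1.2, by rw [e2]; exact hp.2.2⟩
  · funext v
    by_cases h : v ∈ S
    · simp only [glue, dif_pos h, Function.comp]
    · simp only [glue, dif_neg h, Function.comp]
  · have e1 : (glue p) ∘ (Subtype.val : S → V) = p.1 := by
      funext a; simp only [Function.comp, glue, dif_pos a.2]
    have e2 : (glue p) ∘ (Subtype.val : ↥Sᶜ → V) = p.2 := by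
      funext b; have hb : (b : V) ∉ S := b.2; simp only [Function.comp, glue, dif_neg hb]
    exact Prod.ext e1 e2

/-- **Type-vector convolution along an empty cut**: `Q(G) = Σ_{r,u} tv(G[S]) r · tv(G[Sᶜ]) u · lbW (r ⊕ u)`. [this work] -/
theorem Qcol_eq_sum_pair (hS : EmptyCut G S) :
    Qcol G = ∑ r : CType, ∑ u : CType, tv (G.induce S) r * tv (G.induce Sᶜ) u * lbW (ctAdd r u) := by
  rw [Qcol_eq_sum_tv]
  -- split each fibre of `ctype G` by the pair of side types
  have hfib : ∀ t : CType, tv G t = ∑ p ∈ ((univ : Finset CType) ×ˢ (univ : Finset CType)).filter (fun p => ctAdd p.1 p.2 = t),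
      tv (G.induce S) p.1 * tv (G.induce Sᶜ) p.2 := by
    intro t
    have hL : tv G t = ((((univ : Finset (V → Fin 3)).filter fun σ => ctype G σ = t).card : ℕ) : ℤ) := rfl
    rw [hL, card_eq_sum_card_fiberwise (f := fun σ : V → Fin 3 =>
        (ctype (G.induce S) (σ ∘ Subtype.val), ctype (G.induce Sᶜ) (σ ∘ Subtype.val)))
        (t := ((univ : Finset CType) ×ˢ (univ : Finset CType)).filter (fun p => ctAdd p.1 p.2 = t)) ?_]
    · push_cast
      refine sum_congr rfl fun p hp => ?_
      obtain ⟨r, u⟩ := p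
      have hpt : ctAdd r u = t := (mem_filter.1 hp).2
      rw [← card_pair_types G r u]
      congr 2
      ext σ
      simp only [mem_filter, mem_univ, true_and, Prod.mk.injEq]
      constructor
      · rintro ⟨-, h1, h2⟩; exact ⟨h1, h2⟩
      · rintro ⟨h1, h2⟩; exact ⟨by rw [ctype_split G hS, h1, h2, hpt], h1, h2⟩
    · intro σ hσ
      rw [mem_coe, mem_filter] at hσ
      rw [mem_coe, mem_filter]
      refine ⟨mem_product.2 ⟨?_, ?_⟩, by rw [← hσ.2, ctype_split G hS]⟩ <;> simp only [mem_univ]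
  simp_rw [hfib, mul_sum, sum_filter]
  rw [sum_comm]
  simp_rw [sum_product]
  refine sum_congr rfl fun r _ => sum_congr rfl fun u _ => ?_
  rw [sum_ite_eq univ (ctAdd r u) (fun t => lbW t * (tv (G.induce S) r * tv (G.induce Sᶜ) u))]
  simp only [mem_univ, if_true]
  ring

/-- **THEOREM A in colouring language**: Lemma B is closed under gluing along an empty cut. [this work] -/
theorem Qcol_nonneg_of_emptyCut (hS : EmptyCut G S) (h1 : 0 ≤ Qcol (G.induce S)) (h2 : 0 ≤ Qcol (G.induce Sᶜ)) :
    0 ≤ Qcol G := by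
  rw [Qcol_eq_sum_pair G hS]
  rw [Qcol_eq_sum_tv] at h1 h2
  exact lemmaB_pair_nonneg _ _ (tv_nonneg _) (tv_nonneg _) (tv_swap12 _) (tv_swap23 _) (tv_swap12 _) (tv_swap23 _) h1 h2

end Split

/-! ## Lemma B for all graphs from the connected one-point obligation -/

/-- A graph that is not connected but has a vertex splits along a nonempty proper empty cut (a connected component). [this work] -/
theorem exists_emptyCut_of_not_connected {W : Type} [Fintype W] (H : SimpleGraph W) (w : W) (hH : ¬H.Connected) :
    ∃ S : Set W, EmptyCut H S ∧ w ∈ S ∧ ∃ z, z ∉ S := by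
  refine ⟨{z | H.Reachable w z}, fun u v huv => ?_, (SimpleGraph.Reachable.refl w : H.Reachable w w), ?_⟩
  · simp only [Set.mem_setOf_eq]
    exact ⟨fun h => h.trans huv.reachable, fun h => h.trans huv.symm.reachable⟩
  · by_contra hall
    simp only [not_exists, Set.mem_setOf_eq, not_not] at hall
    apply hH
    haveI : Nonempty W := ⟨w⟩
    exact ⟨fun u v => (hall u).symm.trans (hall v)⟩

/-- **LEMMA B FOR EVERY FINITE GRAPH from `MZQConnected`**: a disconnected graph splits along a component (THEOREM A), a connected one peels a
non-cut vertex (`Qcol_nonneg_of_connected`). [this work] -/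
theorem Qcol_nonneg_of_MZQConnected (h : MZQConnected) :
    ∀ (n : ℕ) (W : Type) [Fintype W] (H : SimpleGraph W), Fintype.card W = n → 0 ≤ Qcol H := by
  intro n
  induction n using Nat.strong_induction_on with
  | _ n ih =>
    intro W _ H hcard
    by_cases hconn : H.Connected
    · exact Qcol_nonneg_of_connected' h H hconn
    · by_cases hne : Nonempty W
      · obtain ⟨w⟩ := hne
        obtain ⟨S, hS, hwS, z, hzS⟩ := exists_emptyCut_of_not_connected H w hconn
        have hcS : Fintype.card ↥S < n := by
          rw [← hcard]; exact Fintype.card_subtype_lt (p := fun v => v ∈ S) hzS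
        have hcSc : Fintype.card ↥Sᶜ < n := by
          rw [← hcard]; exact Fintype.card_subtype_lt (p := fun v => v ∈ Sᶜ) (fun hw => hw hwS)
        exact Qcol_nonneg_of_emptyCut H hS (ih _ hcS ↥S (H.induce S) rfl) (ih _ hcSc ↥Sᶜ (H.induce Sᶜ) rfl)
      · haveI : Subsingleton W := ⟨fun a _ => (hne ⟨a⟩).elim⟩
        rw [Qcol_eq_zero_of_subsingleton]

/-- Corollary, unparametrised: under `MZQConnected`, `0 ≤ Qcol H` for every finite graph. [this work] -/
theorem Qcol_nonneg_of_MZQConnected' (h : MZQConnected) {W : Type} [Fintype W] (H : SimpleGraph W) : 0 ≤ Qcol H :=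
  Qcol_nonneg_of_MZQConnected h _ W H rfl

end Summit.CriticalPhenomena.PercolationContinuityZ3.Theorems.SunflowerPartition.Kempe
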